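import Mathlib
import HarnessLib
import Literature.Probability.MarkovChains.MultipleTryIndependenceSampler

/-!
# Andrieu–Lee–Vihola: the i-SIR chain with bounded weights is uniformly ergodic —
# `P_N(x, ·) ≥ ε_N · π` with `ε_N = (N − 1)/(2Ḡ + N − 2)`, hence
# `‖P_Nⁿ(x, ·) − π‖_TV ≤ (1 − ε_N)ⁿ` (finite state spaces)

[cite: AndrieuLeeVihola2018, §1 (summary, second bullet: "If `Ḡ < ∞`, and `N ≥ 2`, the i-SIR
Markov chain is uniformly ergodic with … `‖P_Nⁿ(x,·) − π(·)‖_TV ≤ (1 − (N−1)/(2Ḡ+N−2))ⁿ`"); §4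
(the displayed computation `P_N(x,S) ≥ … ≥ (N−1)/(2Ḡ+N−2) · π(S)` by Jensen's inequality for
`x ↦ (x + a)⁻¹`, and "`ε_N = (N−1)/(2Ḡ+N−2)` provides the upper bound `1 − ε_N` on the (geometric)
rate of convergence")]; restated with "a simple direct proof" as
[cite: SamsonovEtAl2022, §2.1 eq. (tv_dist_isir) (`ε_N = (N−1)/(2L+N−2)`, `κ_N = 1 − ε_N`),
Supplement §8.1 (proof)].

Setting (the tree's `MultipleTryIndependenceSampler.isirKernel q p (n + 1)`): a finite state
space, a target probability vector `p > 0`, a proposal ("model") probability vector `q > 0`,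
weights `w = p/q` bounded by `Ḡ = W` (`p ≤ W q`); one i-SIR update from `x` draws `n + 1` fresh
proposals i.i.d. from `q` and selects the next state from the pool `{x, y_0, …, y_n}` of size
`N = n + 2` with probability `∝ w`.  In these terms `ε_N = (N − 1)/(2Ḡ + N − 2) = (n + 1)/(2W + n)`.

## Content

* `sum_trialProb_mul_weightSum` — `E_q[Σ_{j<n} w(Y_j)] = n` (each weight has mean
  `Σ_y q(y) · p(y)/q(y) = 1`).
* `div_le_mtmH` — JENSEN STEP: `(n+1)/(z + n) ≤ H_{n+1}(z) = E_q[(n+1)/(z + Σ_{j<n} w(Y_j))]`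
  (convexity of `s ↦ (z + s)⁻¹`, here through the Cauchy–Schwarz inequality
  `(Σ T)² ≤ (Σ T·a)(Σ T/a)`).
* **`isirKernel_minorized`** — the WHOLE-SPACE MINORISATION
  `P_N(x, y) ≥ (n+1)/(2W + n) · p(y)` for all `x, y`: drop the "stay" term, write the move part as
  `H_{n+1}(w(x) + w(y)) · p(y)` (`isirMove_eq`), bound `w(x) + w(y) ≤ 2W` and apply the Jensen step.
* **`isir_tvDist_lawAt_le_mul`**, **`isir_tvDist_lawAt_le`** — UNIFORM ERGODICITY: from every
  initial probability vector `μ`, `‖μ P_Nᵗ − p‖_TV ≤ (1 − (n+1)/(2W+n))ᵗ · ‖μ − p‖_TV ≤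
  (1 − (n+1)/(2W+n))ᵗ` (Doeblin contraction, `MengersenTweedie.tvDist_lawAt_le_of_minorized`).

NOT CLAIMED: the general-state-space statement; the asymptotic-variance sandwich
`var_π(f) ≤ var(f, P_N) ≤ [2(1 + (2Ḡ−1)/(N−1)) − 1] var_π(f)` and positivity of `P_N` (the other
bullets of [AndrieuLeeVihola2018, §1]); the converse (no geometric ergodicity when `Ḡ = ∞`);
sharpness of `ε_N`.
-- TODO(general form): general state spaces and the iterated conditional SMC (`T > 1`) of the
-- paper.
-/

namespace Literature.Probability.MarkovChains

open Finset

variable {X : Type*} [Fintype X] [DecidableEq X] {p q : X → ℝ} {W : ℝ}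

omit [Fintype X] [DecidableEq X] in
/-- `∏_j q(ys_j) ≥ 0` (helper). [folklore] -/
private theorem isir_trialProb_nonneg (hq : ∀ x, 0 < q x) {n : ℕ} (ys : Fin n → X) :
    0 ≤ trialProb q ys := by
  unfold trialProb
  exact prod_nonneg fun j _ => (hq _).le

omit [Fintype X] [DecidableEq X] in
/-- `Σ_j w(ys_j) ≥ 0` (helper). [folklore] -/
private theorem isir_weightSum_nonneg (hp : ∀ x, 0 < p x) (hq : ∀ x, 0 < q x) {n : ℕ}
    (ys : Fin n → X) : 0 ≤ weightSum q p ys := by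
  unfold weightSum
  exact sum_nonneg fun j _ => (div_pos (hp _) (hq _)).le

omit [Fintype X] [DecidableEq X] in
/-- A weight bound `p ≤ W·q` with `p, q > 0` forces `W > 0` (helper). [folklore] -/
private theorem isir_weightBound_pos (hp : ∀ x, 0 < p x) (hq : ∀ x, 0 < q x)
    (hW : ∀ x, p x ≤ W * q x) (x : X) : 0 < W :=
  pos_of_mul_pos_left ((hp x).trans_le (hW x)) (hq x).le

omit [DecidableEq X] in
/-- A weight bound `p ≤ W·q` between probability vectors forces `W ≥ 1` (helper). [folklore] -/
private theorem isir_one_le_weightBound (hp1 : ∑ x, p x = 1) (hq1 : ∑ x, q x = 1)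
    (hW : ∀ x, p x ≤ W * q x) : 1 ≤ W := by
  have h : ∑ x, p x ≤ ∑ x, W * q x := sum_le_sum fun x _ => hW x
  rwa [hp1, ← mul_sum, hq1, mul_one] at h

omit [DecidableEq X] in
/-- **Mean of the pool weight**: `E_q[Σ_{j<n} w(Y_j)] = Σ_r ∏_j q(r_j) · Σ_j w(r_j) = n` — each
importance weight has mean `λ(w) = 1` for normalised `p`, `q`.
[cite: AndrieuLeeVihola2018, §4 (the step "`≥ Σ_k ∫ 1{y ∈ S}/(G(x)+G(y)+N−2) π(dy)`": the
`N − 2` free weights have unit mean)]; [cite: SamsonovEtAl2022, Supplement §8.1 (the bound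
"`≥ λ(w)/(w(x) + w(x^i) + (N−2)λ(w))`")] -/
theorem sum_trialProb_mul_weightSum (hp1 : ∑ x, p x = 1) (hq : ∀ x, 0 < q x)
    (hq1 : ∑ x, q x = 1) (n : ℕ) :
    ∑ r : Fin n → X, trialProb q r * weightSum q p r = n := by
  cases n with
  | zero => simp [weightSum]
  | succ n =>
    have h : ∀ j : Fin (n + 1),
        ∑ ys : Fin (n + 1) → X, trialProb q ys * (p (ys j) / q (ys j)) = 1 := by
      intro j
      have h1 := sum_trialProb_mul_weight_mul_removeNth hp1 hq j (fun _ => (1 : ℝ))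
      simp_rw [mul_one] at h1
      rw [h1, sum_trialProb hq1 n]
    calc ∑ r : Fin (n + 1) → X, trialProb q r * weightSum q p r
        = ∑ r : Fin (n + 1) → X, ∑ j, trialProb q r * (p (r j) / q (r j)) :=
          sum_congr rfl fun r _ => by unfold weightSum; rw [mul_sum]
      _ = ∑ j : Fin (n + 1), ∑ r : Fin (n + 1) → X, trialProb q r * (p (r j) / q (r j)) :=
          sum_comm
      _ = ∑ _j : Fin (n + 1), (1 : ℝ) := sum_congr rfl fun j _ => h j
      _ = ((n + 1 : ℕ) : ℝ) := by simp

omit [DecidableEq X] in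
/-- **JENSEN STEP**: `(n+1)/(z + n) ≤ H_{n+1}(z) = E_q[(n+1)/(z + Σ_{j<n} w(Y_j))]` for `z > 0` —
convexity of `s ↦ (z + s)⁻¹` and `E[Σ_{j<n} w(Y_j)] = n`; here via Cauchy–Schwarz,
`1 = (Σ_r T_r)² ≤ (Σ_r T_r (z + S_r)) · (Σ_r T_r/(z + S_r)) = (z + n) · Σ_r T_r/(z + S_r)`.
[cite: AndrieuLeeVihola2018, §4 ("by application of Jensen's inequality to the convex mapping
`x ↦ (x+a)⁻¹`")]; [cite: SamsonovEtAl2022, Supplement §8.1 ("since the function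
`f : z ↦ (z+a)⁻¹` is convex on `ℝ₊`")] -/
theorem div_le_mtmH (hp : ∀ x, 0 < p x) (hp1 : ∑ x, p x = 1) (hq : ∀ x, 0 < q x)
    (hq1 : ∑ x, q x = 1) (n : ℕ) {z : ℝ} (hz : 0 < z) :
    (n + 1) / (z + n) ≤ mtmH q p n z := by
  unfold mtmH
  rw [div_eq_mul_one_div]
  refine mul_le_mul_of_nonneg_left ?_ (by positivity)
  obtain ⟨T, hT⟩ : ∃ T : (Fin n → X) → ℝ, ∀ r, T r = trialProb q r := ⟨_, fun _ => rfl⟩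
  obtain ⟨a, ha⟩ : ∃ a : (Fin n → X) → ℝ, ∀ r, a r = z + weightSum q p r := ⟨_, fun _ => rfl⟩
  have hapos : ∀ r, 0 < a r := fun r => by
    rw [ha]; exact add_pos_of_pos_of_nonneg hz (isir_weightSum_nonneg hp hq r)
  have hT0 : ∀ r, 0 ≤ T r := fun r => by rw [hT]; exact isir_trialProb_nonneg hq r
  have hsumT : ∑ r, T r = 1 := by simp_rw [hT]; exact sum_trialProb hq1 n
  have hsumTa : ∑ r, T r * a r = z + n := by
    simp_rw [hT, ha, mul_add]
    rw [sum_add_distrib, ← sum_mul, sum_trialProb hq1 n, one_mul,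
      sum_trialProb_mul_weightSum hp1 hq hq1 n]
  have hcs := sum_mul_sq_le_sq_mul_sq univ (fun r => Real.sqrt (T r * a r))
    (fun r => Real.sqrt (T r / a r))
  have e1 : ∀ r, Real.sqrt (T r * a r) * Real.sqrt (T r / a r) = T r := by
    intro r
    have har : a r ≠ 0 := (hapos r).ne'
    rw [← Real.sqrt_mul (mul_nonneg (hT0 r) (hapos r).le),
      show T r * a r * (T r / a r) = T r * T r by rw [mul_div_assoc', div_eq_iff har]; ring,
      Real.sqrt_mul_self (hT0 r)]
  have e2 : ∀ r, Real.sqrt (T r * a r) ^ 2 = T r * a r := fun r =>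
    Real.sq_sqrt (mul_nonneg (hT0 r) (hapos r).le)
  have e3 : ∀ r, Real.sqrt (T r / a r) ^ 2 = T r / a r := fun r =>
    Real.sq_sqrt (div_nonneg (hT0 r) (hapos r).le)
  simp_rw [e1, e2, e3, hsumT, hsumTa, one_pow] at hcs
  have hzn : 0 < z + n := by positivity
  rw [div_le_iff₀' hzn]
  calc 1 ≤ (z + n) * ∑ r, T r / a r := hcs
    _ = (z + n) * ∑ r : Fin n → X, trialProb q r / (z + weightSum q p r) := by simp_rw [hT, ha]

/-- **WHOLE-SPACE MINORISATION (uniform Doeblin condition) for i-SIR**: with `n + 1` fresh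
proposals (pool size `N = n + 2`) and weights bounded by `W` (`p ≤ W q`),
`P_N(x, y) ≥ ε_N · p(y)` for ALL `x, y`, `ε_N = (N−1)/(2W + N − 2) = (n+1)/(2W + n)`.
[cite: AndrieuLeeVihola2018, §4 (display "`P_N(x,S) ≥ … ≥ (N−1)/(2Ḡ+N−2) π(S)`: "This is a
uniform minorization condition")]; [cite: SamsonovEtAl2022, Supplement §8.1
eq. (minorise_condition)] -/
theorem isirKernel_minorized (hp : ∀ x, 0 < p x) (hp1 : ∑ x, p x = 1) (hq : ∀ x, 0 < q x)
    (hq1 : ∑ x, q x = 1) (n : ℕ) (hW : ∀ x, p x ≤ W * q x) (x y : X) :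
    (n + 1) / (2 * W + n) * p y ≤ isirKernel q p (n + 1) x y := by
  have hwle : ∀ z, p z / q z ≤ W := fun z => (div_le_iff₀ (hq z)).2 (hW z)
  have hwx : 0 < p x / q x := div_pos (hp x) (hq x)
  have hwy : 0 < p y / q y := div_pos (hp y) (hq y)
  have hmove : (n + 1) / (2 * W + n) * p y ≤ isirMove q p (n + 1) x y := by
    rw [isirMove_eq hq]
    refine mul_le_mul_of_nonneg_right ?_ (hp y).le
    calc ((n : ℝ) + 1) / (2 * W + n) ≤ (n + 1) / ((p x / q x + p y / q y) + n) :=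
          div_le_div_of_nonneg_left (by positivity) (by positivity)
            (by linarith [hwle x, hwle y])
      _ ≤ mtmH q p n (p x / q x + p y / q y) := div_le_mtmH hp hp1 hq hq1 n (add_pos hwx hwy)
  unfold isirKernel
  split_ifs
  · linarith [isirStay_nonneg hp hq (n + 1) x]
  · rw [add_zero]
    exact hmove

omit [DecidableEq X] in
/-- The minorisation constant is a probability: `ε_N = (n+1)/(2W + n) ≤ 1` (indeed `W ≥ 1`).
[cite: AndrieuLeeVihola2018, §4 ("`ε_N = (N−1)/(2Ḡ+N−2) = 1 − (2Ḡ−1)/(2Ḡ+N−2)`")] -/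
theorem isir_minorizationConst_le_one (hp : ∀ x, 0 < p x) (hp1 : ∑ x, p x = 1)
    (hq : ∀ x, 0 < q x) (hq1 : ∑ x, q x = 1) (n : ℕ) (hW : ∀ x, p x ≤ W * q x) :
    ((n : ℝ) + 1) / (2 * W + n) ≤ 1 := by
  obtain ⟨x⟩ : Nonempty X := by
    rw [← not_isEmpty_iff]
    intro h
    rw [Finset.univ_eq_empty, Finset.sum_empty] at hp1
    exact zero_ne_one hp1
  have hW1 : 1 ≤ W := isir_one_le_weightBound hp1 hq1 hW
  have _hW0 : 0 < W := isir_weightBound_pos hp hq hW x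
  rw [div_le_one (by positivity)]
  linarith

/-- **UNIFORM ERGODICITY of i-SIR (contraction form)**: from every initial probability vector `μ`,
`‖μ P_Nᵗ − p‖_TV ≤ (1 − ε_N)ᵗ · ‖μ − p‖_TV`, `ε_N = (n+1)/(2W + n)` (Doeblin contraction under
the whole-space minorisation). [cite: AndrieuLeeVihola2018, §1 (second bullet), §4 ("the
minorization constant … provides the upper bound `1 − ε_N` on the (geometric) rate of
convergence")]; [cite: SamsonovEtAl2022, §2.1 eq. (tv_dist_isir)] -/
theorem isir_tvDist_lawAt_le_mul (hp : ∀ x, 0 < p x) (hp1 : ∑ x, p x = 1) (hq : ∀ x, 0 < q x)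
    (hq1 : ∑ x, q x = 1) (n : ℕ) (hW : ∀ x, p x ≤ W * q x) {μ : X → ℝ} (hμ1 : ∑ x, μ x = 1)
    (t : ℕ) :
    tvDist (lawAt (isirKernel q p (n + 1)) μ t) p ≤
      (1 - (n + 1) / (2 * W + n)) ^ t * tvDist μ p :=
  tvDist_lawAt_le_of_minorized (isirKernel_isRowStochastic hp hq hq1 (n + 1))
    (isirKernel_isStationary hp hq hq1 (n + 1)) hp1 hp1
    (fun x y => isirKernel_minorized hp hp1 hq hq1 n hW x y) hμ1 t

/-- **UNIFORM ERGODICITY of i-SIR, as printed**: `‖μ P_Nᵗ − p‖_TV ≤ (1 − (N−1)/(2Ḡ+N−2))ᵗ` for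
every initial probability vector `μ` (`N = n + 2` the pool size, `Ḡ = W` the weight bound).
[cite: AndrieuLeeVihola2018, §1 (second bullet:
"`‖P_Nⁿ(x,·) − π(·)‖_TV ≤ (1 − (N−1)/(2Ḡ+N−2))ⁿ`")]; [cite: SamsonovEtAl2022, §2.1
eq. (tv_dist_isir)] -/
theorem isir_tvDist_lawAt_le (hp : ∀ x, 0 < p x) (hp1 : ∑ x, p x = 1) (hq : ∀ x, 0 < q x)
    (hq1 : ∑ x, q x = 1) (n : ℕ) (hW : ∀ x, p x ≤ W * q x) {μ : X → ℝ} (hμ : ∀ x, 0 ≤ μ x)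
    (hμ1 : ∑ x, μ x = 1) (t : ℕ) :
    tvDist (lawAt (isirKernel q p (n + 1)) μ t) p ≤ (1 - (n + 1) / (2 * W + n)) ^ t := by
  have h1 : tvDist μ p ≤ 1 := tvDist_le_one hμ (fun x => (hp x).le) hμ1 hp1
  have hβ : 0 ≤ 1 - ((n : ℝ) + 1) / (2 * W + n) :=
    sub_nonneg.2 (isir_minorizationConst_le_one hp hp1 hq hq1 n hW)
  calc tvDist (lawAt (isirKernel q p (n + 1)) μ t) p
      ≤ (1 - (n + 1) / (2 * W + n)) ^ t * tvDist μ p :=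
        isir_tvDist_lawAt_le_mul hp hp1 hq hq1 n hW hμ1 t
    _ ≤ (1 - (n + 1) / (2 * W + n)) ^ t * 1 := mul_le_mul_of_nonneg_left h1 (pow_nonneg hβ t)
    _ = (1 - (n + 1) / (2 * W + n)) ^ t := mul_one _

end Literature.Probability.MarkovChains
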